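import Summits.Ventures.PercRepro.S2ClusterLeverB
import Summits.Ventures.PercRepro.S2TwelveSixK1

/-!
# PercRepro — S2: THE REMAINING SPREAD ROWS BY THE CLUSTER LEVER — `(13, 6)` AT `t = 6, 7, 8` AND THE SCALED `(12, 6)` AT `t = 6, 7, 8`
(p7, gen 15; sub-claim S2)

Each row: three pairwise disjoint triangles (the three-set counts of `S2ThreeSetCounts`) or, by
`S2.exists_clusters_of_no_three_disjoint`, two disjoint clusters of nullities `3, 3` (or `3, 2` with the small cluster on `≤ 5`
points) — every cobasis has `≥ k₁ + k₂` points and every top `5`-set `≥ k₁ + k₂ − 2` points in their union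
(`S2.top_sets_le_of_clusters`): `(13, 6)`: `U ≤ 10010` (`3, 3`) or `≤ 15345` (`3, 2`) against `16460 / 16423 / 16386` at `t = 6 / 7 / 8`
(**`c025_thirteen_six_cf_spread_six_to_eight`**, hence **`c025_thirteen_six_cf_spread_ge_six`**); `(12, 6)` at `K₁ = 10219`:
`U ≤ 12738` against `16206 / 16126 / 16066` (**`c025_twelve_six_cfk1_spread_six_to_eight`**). Nothing about any cell or the
window is claimed. Axioms: standard.
-/

open scoped Matroid

namespace PercRepro

namespace ThmN

open Set

variable {α : Type}

/-- **The spread case of the coloop-free cell `(13, 6)` at `t = 6, 7, 8` triangles**: three pairwise disjoint triangles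
(`c025_thirteen_six_cf_spread_of_three_disjoint`, `U ≤ 16317` against `16460 / 16423 / 16386`) or two disjoint clusters (of
nullities `3, 3`: every cobasis inside their union of `≤ 14` points, every top `5`-set with `≥ 4` points there, `U ≤ 3003 + 7007`;
of nullities `3, 2` on `≤ 12` points: `U ≤ 6468 + 8877`). -/
theorem c025_thirteen_six_cf_spread_six_to_eight (M : Matroid α) [M.Finite]
    (hR : M.eRank = ((13 : ℕ) : ℕ∞)) (hn : M.E.ncard = 13 + 6)
    (hfree : ∀ e ∈ M.E, ∃ A ⊆ M.E \ {e}, e ∉ M.closure A ∧ e ∉ M.closure ((M.E \ {e}) \ A)) (hK : ∀ e, ¬ M.IsColoop e)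
    (h4 : ¬ ∃ W ⊆ M.E, W.ncard ≤ 9 ∧ W.encard = M.eRk W + 4)
    (ht6 : 6 ≤ {C : Set α | M.IsCircuit C ∧ C.ncard = 3}.ncard)
    (ht8 : {C : Set α | M.IsCircuit C ∧ C.ncard = 3}.ncard ≤ 8) : RLS M 13 5 := by
  classical
  have hd : M.E.encard = M.eRank + ((6 : ℕ) : ℕ∞) := by
    rw [hR, ← M.ground_finite.cast_ncard_eq, hn]
    push_cast
    ring
  obtain ⟨hs3, hs4, hs5⟩ := caps_thirteen_six_cf M hd hn hfree hK
  have hflat : ∀ X ⊆ M.E, M.eRk X ≤ 5 → X.ncard ≤ 8 := fun X hX hr => by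
    have := S2.ncard_le_of_eRk_le_of_not_nullity M 4 9 (by norm_num) h4 hX (r := 5) (by norm_num) (by exact_mod_cast hr)
    omega
  have hflat' : ∀ X ⊆ M.E, M.eRk X ≤ 4 → X.ncard ≤ 7 := fun X hX hr => by
    have := S2.ncard_le_of_eRk_le_of_not_nullity M 4 9 (by norm_num) h4 hX (r := 4) (by norm_num) (by exact_mod_cast hr)
    omega
  have hs : ∀ e ∈ M.E, ∀ f ∈ M.E, e ≠ f → M.eRk {e, f} = 2 := by
    intro e he f hf hef
    have h2 : (2 : ℕ∞) ≤ M.eRk {e, f} :=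
      two_le_eRk_of_two_le_ncard_of_free M hfree (pair_subset he hf) (by rw [ncard_pair hef])
    have h3 : M.eRk {e, f} ≤ 2 := by
      have := M.eRk_le_encard {e, f}
      rwa [encard_pair hef] at this
    exact le_antisymm h3 h2
  have hC1 : ∀ L ⊆ M.E, M.eRk L = 2 → L.ncard ≤ 3 :=
    fun L hL hr => ncard_le_three_of_eRk_two M hs hfree hL hr
  have hTfin : {C : Set α | M.IsCircuit C ∧ C.ncard = 3}.Finite :=
    M.ground_finite.finite_subsets.subset (fun C hC => hC.1.subset_ground)
  have h9 : ∀ X ⊆ M.E, X.ncard ≤ 9 → X.encard ≤ M.eRk X + 3 := by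
    intro X hX hX9
    by_contra hlt
    push Not at hlt
    have hk : M.eRk X + 4 ≤ X.encard := by
      have := Order.add_one_le_of_lt hlt
      rwa [add_assoc, show (3 : ℕ∞) + 1 = 4 by norm_num] at this
    obtain ⟨W', hW'X, hW'⟩ := S2.exists_subset_encard_eq_eRk_add M hX 4 hk
    exact h4 ⟨W', hW'X.trans hX, (Set.ncard_le_ncard hW'X (M.ground_finite.subset hX)).trans hX9, hW'⟩
  -- three pairwise disjoint triangles: the three-set counts
  by_cases h3 : ∃ T₁ T₂ T₃ : Set α, M.IsCircuit T₁ ∧ T₁.ncard = 3 ∧ M.IsCircuit T₂ ∧ T₂.ncard = 3 ∧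
      M.IsCircuit T₃ ∧ T₃.ncard = 3 ∧ Disjoint T₁ T₂ ∧ Disjoint T₁ T₃ ∧ Disjoint T₂ T₃
  · obtain ⟨T₁, T₂, T₃, hT₁, hT₁3, hT₂, hT₂3, hT₃, hT₃3, d12, d13, d23⟩ := h3
    exact c025_thirteen_six_cf_spread_of_three_disjoint' M hR hn hfree hK h4 (by omega) hT₁ hT₁3 hT₂ hT₂3 hT₃ hT₃3 d12 d13 d23
  -- otherwise: two disjoint clusters
  obtain ⟨W₁, W₂, k₁, k₂, hW₁, hW₂, hdis, hW₁7, hW₂7, hk₁, hk₂, hcases, -⟩ :=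
    S2.exists_clusters_of_no_three_disjoint M hC1 h9 ht6 h3
  obtain ⟨htop6, htop5⟩ := S2.top_sets_le_of_clusters M hR hn hW₁ hW₂ hdis hk₁ hk₂
  have hw : (W₁ ∪ W₂).ncard ≤ 14 := (Set.ncard_union_le W₁ W₂).trans (by omega)
  -- the numeric bounds: `U ≤ 10010` (nullities `3, 3`) or `U ≤ 15345` (a small cluster, `≤ 12` points)
  have hU15 : {B : Set α | B ⊆ M.E ∧ B.ncard = 5 ∧ M.eRk B = 5 ∧ M.eRk (M.E \ B) = M.eRank}.ncard +
      {B : Set α | B ⊆ M.E ∧ B.ncard = 6 ∧ M.eRk B = 5 ∧ M.eRk (M.E \ B) = M.eRank}.ncard ≤ 15345 := by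
    rcases hcases with ⟨rfl, rfl⟩ | ⟨rfl, rfl, hW₂5⟩ | ⟨rfl, rfl, hW₁5⟩
    · have hnum : (∑ j ∈ Finset.Icc (3 + 3) 6, (W₁ ∪ W₂).ncard.choose j * ((13 + 6) - (W₁ ∪ W₂).ncard).choose (6 - j)) ≤ 3003 ∧
          (∑ j ∈ Finset.Icc (3 + 3 - 2) 5, (W₁ ∪ W₂).ncard.choose j * ((13 + 6) - (W₁ ∪ W₂).ncard).choose (5 - j)) ≤ 7007 := by
        generalize (W₁ ∪ W₂).ncard = w at hw ⊢
        interval_cases w <;> decide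
      have h6 := htop6.trans hnum.1
      have h5 := htop5.trans hnum.2
      omega
    · have hw12 : (W₁ ∪ W₂).ncard ≤ 12 := (Set.ncard_union_le W₁ W₂).trans (by omega)
      have hnum : (∑ j ∈ Finset.Icc (3 + 2) 6, (W₁ ∪ W₂).ncard.choose j * ((13 + 6) - (W₁ ∪ W₂).ncard).choose (6 - j)) ≤ 6468 ∧
          (∑ j ∈ Finset.Icc (3 + 2 - 2) 5, (W₁ ∪ W₂).ncard.choose j * ((13 + 6) - (W₁ ∪ W₂).ncard).choose (5 - j)) ≤ 8877 := by
        generalize (W₁ ∪ W₂).ncard = w at hw12 ⊢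
        interval_cases w <;> decide
      have h6 := htop6.trans hnum.1
      have h5 := htop5.trans hnum.2
      omega
    · have hw12 : (W₁ ∪ W₂).ncard ≤ 12 := (Set.ncard_union_le W₁ W₂).trans (by omega)
      have hnum : (∑ j ∈ Finset.Icc (2 + 3) 6, (W₁ ∪ W₂).ncard.choose j * ((13 + 6) - (W₁ ∪ W₂).ncard).choose (6 - j)) ≤ 6468 ∧
          (∑ j ∈ Finset.Icc (2 + 3 - 2) 5, (W₁ ∪ W₂).ncard.choose j * ((13 + 6) - (W₁ ∪ W₂).ncard).choose (5 - j)) ≤ 8877 := by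
        generalize (W₁ ∪ W₂).ncard = w at hw12 ⊢
        interval_cases w <;> decide
      have h6 := htop6.trans hnum.1
      have h5 := htop5.trans hnum.2
      omega
  -- the cell inequality with `K = 9480`
  have cellA : ∀ (U S m : ℕ) (A : ℚ), Matroid.topCount M 13 5 ≤ U →
      {X : Set α | X ⊆ M.E ∧ M.eRk X = M.eRank}.ncard ≤ S → m ≤ 1024 →
      1024 * (U : ℚ) ≤ ((1024 - m : ℕ) : ℚ) * 2 ^ (6 - 5) * (9480 : ℚ) →
      (1024 : ℚ) * (A + (S : ℚ)) ≤ (m : ℚ) * 2 ^ 19 →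
      ({X : Set α | X ⊆ M.E ∧ M.eRk X ≤ 5}.ncard : ℚ) ≤ A → RLS M 13 5 := by
    intro U S m A hU hS hm hpoly htail hA
    rw [RLS_iff]
    exact c025_core_five_cell_of_counts_xqictq5g M 13 6 (by norm_num) hR hn U hU _ hA S hS
      9480 (by norm_num) (phiK 13 5) (by rw [phiK_thirteen_five]; norm_num) ⟨m, hm, hpoly, htail⟩
  -- the top count is the top `5`-sets plus the top `6`-sets
  have hU1 := S2.topCount_le_ncard_compl_spanning (M := M) hR hd 5
  simp only [Nat.cast_ofNat] at hU1
  have hsplit : {B : Set α | B ⊆ M.E ∧ M.eRk B = 5 ∧ B.ncard ≤ 6 ∧ M.eRk (M.E \ B) = M.eRank}.ncard ≤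
      {B : Set α | B ⊆ M.E ∧ B.ncard = 5 ∧ M.eRk B = 5 ∧ M.eRk (M.E \ B) = M.eRank}.ncard +
      {B : Set α | B ⊆ M.E ∧ B.ncard = 6 ∧ M.eRk B = 5 ∧ M.eRk (M.E \ B) = M.eRank}.ncard := by
    refine le_trans (Set.ncard_le_ncard ?_ ((M.ground_finite.finite_subsets.subset (fun B hB => hB.1)).union
      (M.ground_finite.finite_subsets.subset (fun B hB => hB.1)))) (Set.ncard_union_le _ _)
    rintro B ⟨hBE, hB5, hB6, hBs⟩
    have hBfin : B.Finite := M.ground_finite.subset hBE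
    have h5le : 5 ≤ B.ncard := by
      have := M.eRk_le_encard B
      rw [hB5, ← hBfin.cast_ncard_eq] at this
      exact_mod_cast this
    rcases (show B.ncard = 5 ∨ B.ncard = 6 by omega) with h | h
    · exact Or.inl ⟨hBE, h, hB5, hBs⟩
    · exact Or.inr ⟨hBE, h, hB5, hBs⟩
  have hU' : Matroid.topCount M 13 5 ≤ 15345 := by
    have := hU1.trans hsplit
    omega
  -- the spanning count: three triangles' Bonferroni
  have hS' : {X : Set α | X ⊆ M.E ∧ M.eRk X = M.eRank}.ncard ≤ 28781 := by
    obtain ⟨T₁, T₂, T₃, hT₁, hT₂, hT₃, h12, h13, h23⟩ := (Set.two_lt_ncard_iff hTfin).1 (by omega)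
    have hS := S2.ncard_spanning_add_le_of_three_triangles M hR hn (by norm_num) hC1 hT₁.1 hT₁.2 hT₂.1 hT₂.2 hT₃.1 hT₃.2 h12 h13 h23
    norm_num [Finset.sum_range_succ, Nat.choose] at hS
    omega
  -- the exact triangle count and the tail
  obtain ⟨t, ht⟩ : ∃ t, {C : Set α | M.IsCircuit C ∧ C.ncard = 3}.ncard = t := ⟨_, rfl⟩
  have hA := ncard_eRk_le_five_le_spread M 13 6 (by norm_num) hR hn hfree hflat hflat' t 35 158 ht.le hs4 hs5
  rw [ht] at ht6 ht8
  rcases (show t = 6 ∨ t = 7 ∨ t = 8 by omega) with ht6e | ht7e | ht8e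
  · subst ht6e
    exact cellA _ 28781 135 _ hU' hS' (by norm_num) (by norm_num) (by norm_num [Nat.choose]) hA
  · subst ht7e
    exact cellA _ 28781 137 _ hU' hS' (by norm_num) (by norm_num) (by norm_num [Nat.choose]) hA
  · subst ht8e
    exact cellA _ 28781 139 _ hU' hS' (by norm_num) (by norm_num) (by norm_num [Nat.choose]) hA

/-- **The spread case of the coloop-free cell `(13, 6)` at every `t ≥ 6`.** -/
theorem c025_thirteen_six_cf_spread_ge_six (M : Matroid α) [M.Finite]
    (hR : M.eRank = ((13 : ℕ) : ℕ∞)) (hn : M.E.ncard = 13 + 6)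
    (hfree : ∀ e ∈ M.E, ∃ A ⊆ M.E \ {e}, e ∉ M.closure A ∧ e ∉ M.closure ((M.E \ {e}) \ A)) (hK : ∀ e, ¬ M.IsColoop e)
    (h4 : ¬ ∃ W ⊆ M.E, W.ncard ≤ 9 ∧ W.encard = M.eRk W + 4)
    (ht6 : 6 ≤ {C : Set α | M.IsCircuit C ∧ C.ncard = 3}.ncard) : RLS M 13 5 := by
  by_cases ht9 : 9 ≤ {C : Set α | M.IsCircuit C ∧ C.ncard = 3}.ncard
  · exact c025_thirteen_six_cf_spread_ge_nine M hR hn hfree hK h4 ht9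
  · exact c025_thirteen_six_cf_spread_six_to_eight M hR hn hfree hK h4 ht6 (by omega)

/-- **The spread case of the scaled coloop-free cell `(12, 6)` at `t = 6, 7, 8` triangles**: three pairwise disjoint triangles
(the three-set counts, `U ≤ 6444 + 6237`) or two disjoint clusters (`U ≤ 8190 + 3003` with both nullities `3`, `≤ 7062 + 5676`
with a small cluster) — against `16206 / 16126 / 16066`. -/
theorem c025_twelve_six_cfk1_spread_six_to_eight (M : Matroid α) [M.Finite]
    (hR : M.eRank = ((12 : ℕ) : ℕ∞)) (hn : M.E.ncard = 12 + 6)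
    (hfree : ∀ e ∈ M.E, ∃ A ⊆ M.E \ {e}, e ∉ M.closure A ∧ e ∉ M.closure ((M.E \ {e}) \ A)) (hK : ∀ e, ¬ M.IsColoop e)
    (h4 : ¬ ∃ W ⊆ M.E, W.ncard ≤ 9 ∧ W.encard = M.eRk W + 4)
    (ht6 : 6 ≤ {C : Set α | M.IsCircuit C ∧ C.ncard = 3}.ncard)
    (ht8 : {C : Set α | M.IsCircuit C ∧ C.ncard = 3}.ncard ≤ 8) :
    ((phiK 13 5 - 2) / 2) * (Matroid.topCount M 12 5 : ℚ) ≤ (Matroid.midCount M 12 5 : ℚ) := by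
  classical
  have hd : M.E.encard = M.eRank + ((6 : ℕ) : ℕ∞) := by
    rw [hR, ← M.ground_finite.cast_ncard_eq, hn]
    push_cast
    ring
  obtain ⟨hs3, hs4, hs5⟩ := caps_twelve_six_cf M hd hn hfree hK
  have hflat : ∀ X ⊆ M.E, M.eRk X ≤ 5 → X.ncard ≤ 8 := fun X hX hr => by
    have := S2.ncard_le_of_eRk_le_of_not_nullity M 4 9 (by norm_num) h4 hX (r := 5) (by norm_num) (by exact_mod_cast hr)
    omega
  have hflat' : ∀ X ⊆ M.E, M.eRk X ≤ 4 → X.ncard ≤ 7 := fun X hX hr => by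
    have := S2.ncard_le_of_eRk_le_of_not_nullity M 4 9 (by norm_num) h4 hX (r := 4) (by norm_num) (by exact_mod_cast hr)
    omega
  have hs : ∀ e ∈ M.E, ∀ f ∈ M.E, e ≠ f → M.eRk {e, f} = 2 := by
    intro e he f hf hef
    have h2 : (2 : ℕ∞) ≤ M.eRk {e, f} :=
      two_le_eRk_of_two_le_ncard_of_free M hfree (pair_subset he hf) (by rw [ncard_pair hef])
    have h3 : M.eRk {e, f} ≤ 2 := by
      have := M.eRk_le_encard {e, f}
      rwa [encard_pair hef] at this
    exact le_antisymm h3 h2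
  have hC1 : ∀ L ⊆ M.E, M.eRk L = 2 → L.ncard ≤ 3 :=
    fun L hL hr => ncard_le_three_of_eRk_two M hs hfree hL hr
  have hTfin : {C : Set α | M.IsCircuit C ∧ C.ncard = 3}.Finite :=
    M.ground_finite.finite_subsets.subset (fun C hC => hC.1.subset_ground)
  have h9 : ∀ X ⊆ M.E, X.ncard ≤ 9 → X.encard ≤ M.eRk X + 3 := by
    intro X hX hX9
    by_contra hlt
    push Not at hlt
    have hk : M.eRk X + 4 ≤ X.encard := by
      have := Order.add_one_le_of_lt hlt
      rwa [add_assoc, show (3 : ℕ∞) + 1 = 4 by norm_num] at this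
    obtain ⟨W', hW'X, hW'⟩ := S2.exists_subset_encard_eq_eRk_add M hX 4 hk
    exact h4 ⟨W', hW'X.trans hX, (Set.ncard_le_ncard hW'X (M.ground_finite.subset hX)).trans hX9, hW'⟩
  -- the cell inequality with `K₁ = 10219`
  have cellA : ∀ (U S m : ℕ) (A : ℚ), Matroid.topCount M 12 5 ≤ U →
      {X : Set α | X ⊆ M.E ∧ M.eRk X = M.eRank}.ncard ≤ S → m ≤ 1024 →
      1024 * (U : ℚ) ≤ ((1024 - m : ℕ) : ℚ) * 2 ^ (6 - 5) * (10219 : ℚ) →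
      (1024 : ℚ) * (A + (S : ℚ)) ≤ (m : ℚ) * 2 ^ 18 →
      ({X : Set α | X ⊆ M.E ∧ M.eRk X ≤ 5}.ncard : ℚ) ≤ A →
      ((phiK 13 5 - 2) / 2) * (Matroid.topCount M 12 5 : ℚ) ≤ (Matroid.midCount M 12 5 : ℚ) := by
    intro U S m A hU hS hm hpoly htail hA
    exact c025_core_five_cell_of_counts_xqictq5g M 12 6 (by norm_num) hR hn U hU _ hA S hS
      10219 (by norm_num) ((phiK 13 5 - 2) / 2) (by rw [phiK_thirteen_five]; norm_num) ⟨m, hm, hpoly, htail⟩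
  -- the top count is the top `5`-sets plus the top `6`-sets
  have hU1 := S2.topCount_le_ncard_compl_spanning (M := M) hR hd 5
  simp only [Nat.cast_ofNat] at hU1
  have hsplit : {B : Set α | B ⊆ M.E ∧ M.eRk B = 5 ∧ B.ncard ≤ 6 ∧ M.eRk (M.E \ B) = M.eRank}.ncard ≤
      {B : Set α | B ⊆ M.E ∧ B.ncard = 5 ∧ M.eRk B = 5 ∧ M.eRk (M.E \ B) = M.eRank}.ncard +
      {B : Set α | B ⊆ M.E ∧ B.ncard = 6 ∧ M.eRk B = 5 ∧ M.eRk (M.E \ B) = M.eRank}.ncard := by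
    refine le_trans (Set.ncard_le_ncard ?_ ((M.ground_finite.finite_subsets.subset (fun B hB => hB.1)).union
      (M.ground_finite.finite_subsets.subset (fun B hB => hB.1)))) (Set.ncard_union_le _ _)
    rintro B ⟨hBE, hB5, hB6, hBs⟩
    have hBfin : B.Finite := M.ground_finite.subset hBE
    have h5le : 5 ≤ B.ncard := by
      have := M.eRk_le_encard B
      rw [hB5, ← hBfin.cast_ncard_eq] at this
      exact_mod_cast this
    rcases (show B.ncard = 5 ∨ B.ncard = 6 by omega) with h | h
    · exact Or.inl ⟨hBE, h, hB5, hBs⟩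
    · exact Or.inr ⟨hBE, h, hB5, hBs⟩
  have hUsum := hU1.trans hsplit
  -- the spanning count: three triangles' Bonferroni
  have hS' : {X : Set α | X ⊆ M.E ∧ M.eRk X = M.eRank}.ncard ≤ 21313 := by
    obtain ⟨T₁, T₂, T₃, hT₁, hT₂, hT₃, h12, h13, h23⟩ := (Set.two_lt_ncard_iff hTfin).1 (by omega)
    have hS := S2.ncard_spanning_add_le_of_three_triangles M hR hn (by norm_num) hC1 hT₁.1 hT₁.2 hT₂.1 hT₂.2 hT₃.1 hT₃.2 h12 h13 h23
    norm_num [Finset.sum_range_succ, Nat.choose] at hS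
    omega
  -- THE TOP COUNT `≤ 12738`: three pairwise disjoint triangles, or two clusters
  have hU' : Matroid.topCount M 12 5 ≤ 12738 := by
    by_cases h3 : ∃ T₁ T₂ T₃ : Set α, M.IsCircuit T₁ ∧ T₁.ncard = 3 ∧ M.IsCircuit T₂ ∧ T₂.ncard = 3 ∧
        M.IsCircuit T₃ ∧ T₃.ncard = 3 ∧ Disjoint T₁ T₂ ∧ Disjoint T₁ T₃ ∧ Disjoint T₂ T₃
    · obtain ⟨T₁, T₂, T₃, hT₁, hT₁3, hT₂, hT₂3, hT₃, hT₃3, d12, d13, d23⟩ := h3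
      have hfinT : ∀ {T : Set α}, M.IsCircuit T → T.Finite := fun hT => M.ground_finite.subset hT.subset_ground
      have hne_of_disj : ∀ {T T' : Set α}, T.ncard = 3 → Disjoint T T' → T ≠ T' := by
        intro T T' hT3 hdis heq
        subst heq
        have hemp : T = ∅ := by
          rw [← Set.inter_self T]
          exact Set.disjoint_iff_inter_eq_empty.1 hdis
        rw [hemp, Set.ncard_empty] at hT3
        omega
      have n12 : T₁ ≠ T₂ := hne_of_disj hT₁3 d12
      have n13 : T₁ ≠ T₃ := hne_of_disj hT₁3 d13
      have n23 : T₂ ≠ T₃ := hne_of_disj hT₂3 d23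
      have hsize2 : ∀ {T T' : Set α}, M.IsCircuit T → T.ncard = 3 → M.IsCircuit T' → T'.ncard = 3 → Disjoint T T' →
          (M.E \ (T ∪ T')).ncard = 12 := by
        intro T T' hT hT3 hT' hT'3 hdis
        have hsub : T ∪ T' ⊆ M.E := Set.union_subset hT.subset_ground hT'.subset_ground
        have h := Set.ncard_sdiff_add_ncard_of_subset hsub M.ground_finite
        have hu := Set.ncard_union_eq hdis (hfinT hT) (hfinT hT')
        omega
      have hsize3 : (M.E \ (T₁ ∪ T₂ ∪ T₃)).ncard = 9 := by
        have hsub : T₁ ∪ T₂ ∪ T₃ ⊆ M.E :=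
          Set.union_subset (Set.union_subset hT₁.subset_ground hT₂.subset_ground) hT₃.subset_ground
        have h := Set.ncard_sdiff_add_ncard_of_subset hsub M.ground_finite
        have hu12 := Set.ncard_union_eq d12 (hfinT hT₁) (hfinT hT₂)
        have hu : (T₁ ∪ T₂ ∪ T₃).ncard = (T₁ ∪ T₂).ncard + T₃.ncard :=
          Set.ncard_union_eq (Set.disjoint_union_left.2 ⟨d13, d23⟩) ((hfinT hT₁).union (hfinT hT₂)) (hfinT hT₃)
        omega
      have hsize1 : ∀ {T : Set α}, M.IsCircuit T → T.ncard = 3 → (M.E \ T).ncard = 15 := by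
        intro T hT hT3
        have h := Set.ncard_sdiff_add_ncard_of_subset hT.subset_ground M.ground_finite
        omega
      have htop5' : {B : Set α | B ⊆ M.E ∧ B.ncard = 5 ∧ M.eRk B = 5 ∧ M.eRk (M.E \ B) = M.eRank}.ncard ≤ 6444 := by
        have hhit12 := S2.top_five_inter_union_nonempty M hR hn hT₁ hT₂ n12
        have hhit13 := S2.top_five_inter_union_nonempty M hR hn hT₁ hT₃ n13
        have hhit23 := S2.top_five_inter_union_nonempty M hR hn hT₂ hT₃ n23
        have hsub : {B : Set α | B ⊆ M.E ∧ B.ncard = 5 ∧ M.eRk B = 5 ∧ M.eRk (M.E \ B) = M.eRank} ⊆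
            {X : Set α | X ⊆ M.E ∧ X.ncard = 5 ∧
              (((X ∩ T₁).Nonempty ∧ (X ∩ T₂).Nonempty) ∨ ((X ∩ T₁).Nonempty ∧ (X ∩ T₃).Nonempty) ∨
                ((X ∩ T₂).Nonempty ∧ (X ∩ T₃).Nonempty))} := by
          rintro B ⟨hBE, hB5, -, hBs⟩
          exact ⟨hBE, hB5, two_of_three_of_pair_unions (hhit12 B hBE hB5 hBs) (hhit13 B hBE hB5 hBs) (hhit23 B hBE hB5 hBs)⟩
        have hle := Set.ncard_le_ncard hsub (M.ground_finite.finite_subsets.subset (fun X hX => hX.1))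
        have hcount := S2.ncard_subsets_two_of_three_add_le M.E T₁ T₂ T₃ M.ground_finite 5
        rw [hn, hsize2 hT₁ hT₁3 hT₂ hT₂3 d12, hsize2 hT₁ hT₁3 hT₃ hT₃3 d13, hsize2 hT₂ hT₂3 hT₃ hT₃3 d23, hsize3] at hcount
        norm_num [Nat.choose] at hcount
        omega
      have htop6' : {B : Set α | B ⊆ M.E ∧ B.ncard = 6 ∧ M.eRk B = 5 ∧ M.eRk (M.E \ B) = M.eRank}.ncard ≤ 6237 := by
        have hmeet : ∀ B ⊆ M.E, B.ncard = 6 → M.eRk (M.E \ B) = M.eRank → ∀ {C : Set α}, M.IsCircuit C → (B ∩ C).Nonempty := by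
          intro B hBE hB6 hBs C hC
          by_contra hemp
          rw [Set.not_nonempty_iff_eq_empty, ← Set.disjoint_iff_inter_eq_empty] at hemp
          have hCsub : C ⊆ M.E \ B := Set.subset_sdiff.2 ⟨hC.subset_ground, hemp.symm⟩
          have hfinEB : (M.E \ B).Finite := M.ground_finite.subset sdiff_subset
          have hcard : (M.E \ B).ncard = 12 := by
            have h := Set.ncard_sdiff_add_ncard_of_subset hBE M.ground_finite
            omega
          have hind : M.Indep (M.E \ B) := by
            rw [Matroid.indep_iff_eRk_eq_encard_of_finite hfinEB, hBs, hR, ← hfinEB.cast_ncard_eq, hcard]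
          exact hC.dep.not_indep (hind.subset hCsub)
        have hsub : {B : Set α | B ⊆ M.E ∧ B.ncard = 6 ∧ M.eRk B = 5 ∧ M.eRk (M.E \ B) = M.eRank} ⊆
            {X : Set α | X ⊆ M.E ∧ X.ncard = 6 ∧ (X ∩ T₁).Nonempty ∧ (X ∩ T₂).Nonempty ∧ (X ∩ T₃).Nonempty} := by
          rintro B ⟨hBE, hB6, -, hBs⟩
          exact ⟨hBE, hB6, hmeet B hBE hB6 hBs hT₁, hmeet B hBE hB6 hBs hT₂, hmeet B hBE hB6 hBs hT₃⟩
        have hle := Set.ncard_le_ncard hsub (M.ground_finite.finite_subsets.subset (fun X hX => hX.1))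
        have hcount := S2.ncard_subsets_inter_nonempty_three_add_le M.E T₁ T₂ T₃ M.ground_finite 6
        rw [hn, hsize1 hT₁ hT₁3, hsize1 hT₂ hT₂3, hsize1 hT₃ hT₃3, hsize2 hT₁ hT₁3 hT₂ hT₂3 d12,
          hsize2 hT₁ hT₁3 hT₃ hT₃3 d13, hsize2 hT₂ hT₂3 hT₃ hT₃3 d23, hsize3] at hcount
        norm_num [Nat.choose] at hcount
        omega
      omega
    · obtain ⟨W₁, W₂, k₁, k₂, hW₁, hW₂, hdis, hW₁7, hW₂7, hk₁, hk₂, hcases, -⟩ :=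
        S2.exists_clusters_of_no_three_disjoint M hC1 h9 ht6 h3
      obtain ⟨htop6, htop5⟩ := S2.top_sets_le_of_clusters M hR hn hW₁ hW₂ hdis hk₁ hk₂
      have hw14 : (W₁ ∪ W₂).ncard ≤ 14 := (Set.ncard_union_le W₁ W₂).trans (by omega)
      rcases hcases with ⟨rfl, rfl⟩ | ⟨rfl, rfl, hW₂5⟩ | ⟨rfl, rfl, hW₁5⟩
      · have hnum : (∑ j ∈ Finset.Icc (3 + 3) 6, (W₁ ∪ W₂).ncard.choose j * ((12 + 6) - (W₁ ∪ W₂).ncard).choose (6 - j)) ≤ 3003 ∧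
            (∑ j ∈ Finset.Icc (3 + 3 - 2) 5, (W₁ ∪ W₂).ncard.choose j * ((12 + 6) - (W₁ ∪ W₂).ncard).choose (5 - j)) ≤ 6006 := by
          generalize (W₁ ∪ W₂).ncard = w at hw14 ⊢
          interval_cases w <;> decide
        have h6 := htop6.trans hnum.1
        have h5 := htop5.trans hnum.2
        omega
      · have hw12 : (W₁ ∪ W₂).ncard ≤ 12 := (Set.ncard_union_le W₁ W₂).trans (by omega)
        have hnum : (∑ j ∈ Finset.Icc (3 + 2) 6, (W₁ ∪ W₂).ncard.choose j * ((12 + 6) - (W₁ ∪ W₂).ncard).choose (6 - j)) ≤ 5676 ∧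
            (∑ j ∈ Finset.Icc (3 + 2 - 2) 5, (W₁ ∪ W₂).ncard.choose j * ((12 + 6) - (W₁ ∪ W₂).ncard).choose (5 - j)) ≤ 7062 := by
          generalize (W₁ ∪ W₂).ncard = w at hw12 ⊢
          interval_cases w <;> decide
        have h6 := htop6.trans hnum.1
        have h5 := htop5.trans hnum.2
        omega
      · have hw12 : (W₁ ∪ W₂).ncard ≤ 12 := (Set.ncard_union_le W₁ W₂).trans (by omega)
        have hnum : (∑ j ∈ Finset.Icc (2 + 3) 6, (W₁ ∪ W₂).ncard.choose j * ((12 + 6) - (W₁ ∪ W₂).ncard).choose (6 - j)) ≤ 5676 ∧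
            (∑ j ∈ Finset.Icc (2 + 3 - 2) 5, (W₁ ∪ W₂).ncard.choose j * ((12 + 6) - (W₁ ∪ W₂).ncard).choose (5 - j)) ≤ 7062 := by
          generalize (W₁ ∪ W₂).ncard = w at hw12 ⊢
          interval_cases w <;> decide
        have h6 := htop6.trans hnum.1
        have h5 := htop5.trans hnum.2
        omega
  -- the exact triangle count and the tail
  obtain ⟨t, ht⟩ : ∃ t, {C : Set α | M.IsCircuit C ∧ C.ncard = 3}.ncard = t := ⟨_, rfl⟩
  have hA := ncard_eRk_le_five_le_spread M 12 6 (by norm_num) hR hn hfree hflat hflat' t 36 162 ht.le hs4 hs5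
  rw [ht] at ht6 ht8
  rcases (show t = 6 ∨ t = 7 ∨ t = 8 by omega) with ht6e | ht7e | ht8e
  · subst ht6e
    exact cellA _ 21313 212 _ hU' hS' (by norm_num) (by norm_num) (by norm_num [Nat.choose]) hA
  · subst ht7e
    exact cellA _ 21313 216 _ hU' hS' (by norm_num) (by norm_num) (by norm_num [Nat.choose]) hA
  · subst ht8e
    exact cellA _ 21313 219 _ hU' hS' (by norm_num) (by norm_num) (by norm_num [Nat.choose]) hA

end ThmN

end PercRepro
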